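import Mathlib
import HarnessLib
import Summits.Ventures.LatticeQCDFlow.Exactness.IMHMultiProposalStickingFloor
import Summits.Ventures.LatticeQCDFlow.Exactness.IMHFlowDivergenceDictionary

/-!
# Do not put the current configuration into the free-energy estimate: at equilibrium the pool-averaged weight of the ensemble sampler
# overestimates the normaliser by the factor `1 + χ²/(n + 1)`, while the `n` fresh proposals alone estimate it exactly

HONEST FRAMING: exact (Metropolis-corrected) sampling algorithms for lattice gauge theory;
figures of merit are autocorrelation/cost numbers at stated couplings and volumes; no
continuum-physics claim.

Venture `LatticeQCDFlow` (cell pub-lqcd), topic `Exactness`; FANOUT row 30 (lean-1, GEN-42).  NEW WORK of the cell (general state space, over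
Mathlib, this generation's `IMHMultiProposalStickingFloor.integral_sum_weight_eq_of_integrable` and GEN-40's `IMHFlowDivergenceDictionary`).  Flow samplers estimate the partition-function
ratio `Z = E_q[w̃]` from their proposals (`w̃ = e^{−S}/q̃` unnormalised); the ensemble sampler carries a pool of `n` proposals PLUS the current
configuration, and the temptation is to average all `n + 1` weights.  With the normalised weight `w = w̃/Z` (`∫ w dq = 1`) and
`1 + χ² = ∫ w² dq`:

## Results (no `sorry`, no new definitions)
* `integral_weight_target_eq_sq` — `∫ w dπ = ∫ w² dq` for `π = w·q` (the current configuration is `π`-distributed, and `π` sees the weight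
  size-biased); the tree's `IMHFlowDivergenceDictionary.integral_sq_eq_one_add_chiSq` gives `∫ w² dq = 1 + ∫ (w − 1)² dq = 1 + χ²`.
* **`proposals_mean_weight_eq_one`** — `E_{q^{⊗n}}[(Σ_i w(y_i))/n] = 1`: the proposals' average weight is UNBIASED for the (normalised) normaliser.
* **`pool_mean_weight_eq`** — `E_{π ⊗ q^{⊗n}}[(w(x) + Σ_i w(y_i))/(n + 1)] = (∫ w² dq + n)/(n + 1) = 1 + χ²/(n + 1)`: including the current
  configuration biases the estimate UP by the relative amount `χ²/(n + 1)` (`pool_mean_weight_eq_chiSq`), strictly unless the flow is perfect.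
Reading (gauge files): report `Z`-hat (free-energy differences) from the flow proposals only; the visited configurations of the exact chain are
`π`-distributed and their weights are size-biased by exactly `1 + χ²`.  NOT CLAIMED: variances of either estimator; anything away from
equilibrium.
-/

noncomputable section

open scoped ENNReal

namespace Summit.Ventures.LatticeQCDFlow.Exactness

open MeasureTheory ProbabilityTheory Function Finset

variable {Ω : Type*} [MeasurableSpace Ω] {q : Measure Ω} [IsProbabilityMeasure q] {w : Ω → ℝ} {n : ℕ}

omit [IsProbabilityMeasure q] in
/-- **The target sees the weight size-biased**: `∫ w dπ = ∫ w² dq` for `π = w·q`. [ours] -/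
theorem integral_weight_target_eq_sq (hw : Measurable w) (hw0 : ∀ x, 0 < w x) :
    ∫ x, w x ∂(q.withDensity fun x => ENNReal.ofReal (w x)) = ∫ x, w x ^ 2 ∂q := by
  rw [integral_withDensity_eq_integral_toReal_smul hw.ennreal_ofReal (ae_of_all _ fun x => ENNReal.ofReal_lt_top)]
  refine integral_congr_ae (ae_of_all _ fun x => ?_)
  simp only [ENNReal.toReal_ofReal (hw0 x).le, smul_eq_mul, sq]

/-- **THE PROPOSALS ALONE ARE UNBIASED**: `E_{q^{⊗n}}[(Σ_i w(y_i))/n] = 1` (`n ≥ 1`). [ours] -/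
theorem proposals_mean_weight_eq_one [NeZero n] (hw : Measurable w) (h1 : ∫ x, w x ∂q = 1) :
    ∫ y, (∑ i, w (y i)) / n ∂(Measure.pi fun _ : Fin n => q) = 1 := by
  have hwi : Integrable w q := by
    by_contra h; rw [integral_undef h] at h1; exact zero_ne_one h1
  rw [integral_div, integral_sum_weight_eq_of_integrable hw hwi, h1, mul_one, div_self (Nat.cast_ne_zero.2 (NeZero.ne n))]

/-- **THE POOL MEAN IS BIASED UP**: `E_{π ⊗ q^{⊗n}}[(w(x) + Σ_i w(y_i))/(n + 1)] = (∫ w² dq + n)/(n + 1)` at equilibrium (`x ∼ π`, proposals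
`∼ q^{⊗n}` independent of `x`; iterated form). [ours] -/
theorem pool_mean_weight_eq (hw : Measurable w) (hw0 : ∀ x, 0 < w x) (hmem : MemLp w 2 q) (h1 : ∫ x, w x ∂q = 1)
    [IsProbabilityMeasure (q.withDensity fun x => ENNReal.ofReal (w x))] :
    ∫ x, ∫ y, (w x + ∑ i, w (y i)) / (n + 1) ∂(Measure.pi fun _ : Fin n => q) ∂(q.withDensity fun x => ENNReal.ofReal (w x)) =
      ((∫ x, w x ^ 2 ∂q) + n) / (n + 1) := by
  set π := q.withDensity fun x => ENNReal.ofReal (w x) with hπ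
  have hwi : Integrable w q := hmem.integrable one_le_two
  have hSi : Integrable (fun y : Fin n → Ω => ∑ i, w (y i)) (Measure.pi fun _ : Fin n => q) :=
    integrable_finsetSum _ fun i _ => ((measurePreserving_eval (fun _ : Fin n => q) i).integrable_comp hw.aestronglyMeasurable).2 hwi
  -- inner integral: `(w x + n)/(n+1)`
  have hin : ∀ x, ∫ y, (w x + ∑ i, w (y i)) / (n + 1) ∂(Measure.pi fun _ : Fin n => q) = (w x + n) / (n + 1) := fun x => by
    rw [integral_div, integral_add (integrable_const _) hSi, integral_const, smul_eq_mul, probReal_univ, one_mul,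
      integral_sum_weight_eq_of_integrable hw hwi, h1, mul_one]
  simp_rw [hin]
  -- outer integral against `π`: `w` is `π`-integrable because `w ∈ L²(q)`
  have hwπ : Integrable w π := by
    have hden : (fun x => ENNReal.ofReal (w x)) = fun x => ((w x).toNNReal : ENNReal) := rfl
    rw [hπ, hden, integrable_withDensity_iff_integrable_smul hw.real_toNNReal]
    refine hmem.integrable_sq.congr (ae_of_all _ fun x => ?_)
    show w x ^ 2 = (w x).toNNReal • w x
    rw [NNReal.smul_def, smul_eq_mul, Real.coe_toNNReal _ (hw0 x).le, sq]
  rw [integral_div, integral_add hwπ (integrable_const _), integral_const, smul_eq_mul, probReal_univ, one_mul,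
    integral_weight_target_eq_sq hw hw0]

/-- **… i.e. `1 + χ²/(n + 1)`**: the relative upward bias of the pool mean as a normaliser estimate is `χ²/(n + 1)`. [ours] -/
theorem pool_mean_weight_eq_chiSq (hw : Measurable w) (hw0 : ∀ x, 0 < w x) (hmem : MemLp w 2 q) (h1 : ∫ x, w x ∂q = 1)
    [IsProbabilityMeasure (q.withDensity fun x => ENNReal.ofReal (w x))] :
    ∫ x, ∫ y, (w x + ∑ i, w (y i)) / (n + 1) ∂(Measure.pi fun _ : Fin n => q) ∂(q.withDensity fun x => ENNReal.ofReal (w x)) =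
      1 + (∫ x, (w x - 1) ^ 2 ∂q) / (n + 1) := by
  rw [pool_mean_weight_eq hw hw0 hmem h1, integral_sq_eq_one_add_chiSq hmem h1]
  have hn : (n : ℝ) + 1 ≠ 0 := by positivity
  field_simp
  ring

end Summit.Ventures.LatticeQCDFlow.Exactness
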